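import Mathlib
import Summits.Ventures.PercRepro2.Defs
import Summits.Ventures.PercRepro2.Graph
import Summits.Ventures.PercRepro2.Induced
import Summits.Ventures.PercRepro2.VdBKahn
import Summits.Ventures.PercRepro2.ReimerVdBK
import Summits.Ventures.PercRepro2.ReimerVdBKRegions
import Summits.Ventures.PercRepro2.ReimerVdBKZClosed
import Summits.Ventures.PercRepro2.ReimerVdBKZReduction
import Summits.Ventures.PercRepro2.ReimerVdBKZSplit
import Summits.Ventures.PercRepro2.ReimerVdBKZRecursion
import Summits.Ventures.PercRepro2.ReimerVdBKTypeWeight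
import Summits.Ventures.PercRepro2.ReimerVdBKPairType

/-!
# A vertex with at most one non-loop edge is never in the core
(blind cell PercRepro2, mine-c g46; `conjectures/MINE-C.md` §55.5)

A vertex `v ≠ s` lies in the core `K₁ ∩ K₂` only if some non-loop edge at `v` is open in world 1 and some
non-loop edge at `v` is open in world 2 — two distinct edges.  So if `v` carries at most one non-loop edge,
the core-avoidance weight `F 0 = (0, 1, 1, 1)` at `v` is identically `1` there: `pcount` does not see the
difference between `F 0` and `U` at `v` (`pcount_update_F0_eq_U`), and the pair statement with `F 0` at `v`
is the pair statement with `U` at `v` (`pstmt_update_F0_iff_U`).  In the recursion of `pstmt_of_harris` this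
is the LEAF RULE: a frontier vertex that has become a leaf costs nothing.  With it the calculus settles
98.7 % / 96.4 % of the `Z ≠ ∅` instances on 4 / 5 vertices (reach2.py, one split order), against 87.6 % /
80.6 % for `rvdBK_of_closed_marked`.
-/

namespace Summit.Ventures.PercRepro2
namespace ReimerVdBK
open Classical PairType

variable {V : Type*} {E : Type*} [Fintype E] [DecidableEq E] [Fintype V] [DecidableEq V]
variable (ends : E → Sym2 V) (s : V)

omit [Fintype E] [DecidableEq E] [Fintype V] [DecidableEq V] in
/-- If `e` is the only non-loop edge at `v ≠ s`, then `s` reaches `v` only through `e`: `s ↔ v` forces `e`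
open. -/
lemma open_of_conn_of_unique {v : V} {e : E} (hsv : s ≠ v)
    (hu : ∀ f, v ∈ ends f → ¬ (ends f).IsDiag → f = e) {ω : Config E} (h : Conn ends ω s v) :
    ω e = true := by
  let S : Set V := {x | x ≠ v ∨ ω e = true}
  have hS : ∀ x ∈ S, ∀ y, (openGraph ends ω).Adj x y → y ∈ S := by
    intro x hx y hxy
    by_cases hyv : y = v
    · obtain ⟨hne, f, hf, hends⟩ := openGraph_adj.1 hxy
      have hvf : v ∈ ends f := by rw [hends, ← hyv]; exact Sym2.mem_mk_right x y
      have hnd : ¬ (ends f).IsDiag := by rw [hends, Sym2.mk_isDiag_iff]; exact hne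
      have := hu f hvf hnd
      rw [this] at hf
      exact Or.inr hf
    · exact Or.inl hyv
  have := mem_of_conn_of_closed hS (Or.inl hsv) h
  rcases this with h' | h'
  · exact absurd rfl h'
  · exact h'

omit [Fintype E] [DecidableEq E] [Fintype V] [DecidableEq V] in
/-- **A vertex with at most one non-loop edge is never in both worlds.** -/
theorem not_core_of_unique {v : V} {e : E} (hsv : s ≠ v)
    (hu : ∀ f, v ∈ ends f → ¬ (ends f).IsDiag → f = e) (ω : Config E) :
    ¬ (Conn ends ω s v ∧ Conn ends (compl ω) s v) := by
  rintro ⟨h1, h2⟩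
  have e1 := open_of_conn_of_unique ends s hsv hu h1
  have e2 := open_of_conn_of_unique ends s hsv hu h2
  simp [compl, e1] at e2

/-- **The leaf rule**: at a vertex with at most one non-loop edge the core-avoidance weight `(0,1,1,1)`
counts exactly as the unit weight `(1,1,1,1)`. -/
theorem pcount_update_F0_eq_U (W : V → TW) {v : V} {e : E} (hsv : s ≠ v)
    (hu : ∀ f, v ∈ ends f → ¬ (ends f).IsDiag → f = e) :
    pcount ends s (Function.update W v (0, 1, 1, 1)) = pcount ends s (Function.update W v (1, 1, 1, 1)) := by
  apply pcount_congr
  intro ω u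
  by_cases huv : u = v
  · subst huv
    rw [vw_update_self, vw_update_self]
    have h := not_core_of_unique ends s hsv hu ω
    rcases Classical.em (Conn ends ω s u) with h1 | h1 <;>
      rcases Classical.em (Conn ends (compl ω) s u) with h2 | h2
    · exact absurd ⟨h1, h2⟩ h
    · rw [cdec_eq_true h1, cdec_eq_false h2]; rfl
    · rw [cdec_eq_false h1, cdec_eq_true h2]; rfl
    · rw [cdec_eq_false h1, cdec_eq_false h2]; rfl
  · rw [vw_update_of_ne ends s W huv, vw_update_of_ne ends s W huv]

/-- The pair statement with the frontier type `F 0` at a vertex with at most one non-loop edge is the pair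
statement with `U` there. -/
theorem pstmt_update_F0_iff_U (P : V → PairType) {v : V} {e : E} (hsv : s ≠ v)
    (hu : ∀ f, v ∈ ends f → ¬ (ends f).IsDiag → f = e) :
    PStmt ends s (Function.update P v (F 0)) ↔ PStmt ends s (Function.update P v U) := by
  unfold PStmt
  rw [comp_update, comp_update, comp_update, comp_update]
  have hl := pcount_update_F0_eq_U ends s (lwt ∘ P) hsv hu
  have hr := pcount_update_F0_eq_U ends s (rwt ∘ P) hsv hu
  simp only [lwt, rwt, pow_zero] at hl hr ⊢
  rw [hl, hr]

end ReimerVdBK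
end Summit.Ventures.PercRepro2
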